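import Summits.QuantumAdvantage.QuantumAdvantage.Theorems.SteerDialLocal
import Mathlib.LinearAlgebra.LinearIndependent.Lemmas
import Mathlib.LinearAlgebra.Basis.VectorSpace
import Mathlib.LinearAlgebra.Dimension.Constructions
import Mathlib.LinearAlgebra.Dimension.Finite

/-!
# SteerDial (13a): SteerDialAffineLemmas — LEMMA R, the column/recurrence dichotomy, counting helpers

Part 13a (lemmas; the assembly is part 13b `SteerDialAffine`) of the prover-side twin of the lineage decomp-qadv-lens-5 steering programme, generation 9, workshop node
«TagDial» rev 5 §9–§10.  The re-typed residual of item 30909 is `InvCover3 ∧ InvModCover3` (part 11,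
`steerDial_algCover3_of_inv`); the strategy-free dichotomy `InvModCover3` («modulo a rotation-invariant dense
polylog-degree body event of the certifier's choosing, a certified polylog rotation list covers all but `2ⁿ/n^{k'}`
bodies of every dense polylog-degree event») is FALSE without the invariant factor (part 12 / the critic's certificate:
class-weight tests) and is here PROVED on the AFFINE-SYSTEM FAMILY `ψ := 1 − [E](x|_{[0,n)})`, `E ⊆ {0,1}ⁿ` cut out by
`S ≤ (log₂ n)^c` affine forms over `𝔽₃` — the family containing every adversary on record (class weights, weight
residues, periodic profiles, planted tags and their intersections): `steerDial_invModCover3Affine`.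
Proof = a column/recurrence DICHOTOMY for the rotated system `{ℓ_s(rot^t y) = b_s : s < S, t < T}`, `T = (k'+1)(L+1)`,
`L = log₂ n`: `cols_dichotomy` (rank-free, via `exists_linearIndependent'` + `Submodule.exists_le_ker_of_lt_top`) gives
EITHER `T` coordinates carrying linearly independent columns — then LEMMA R `card_solSet_mul_le` (restriction off those
coordinates is injective on each fibre; junta product bounds of part 10) bounds the bodies whose first `T` rotations stay
in `E` by `2^{n−T} ≤ 2ⁿ/n^{k'}`, with `φ := 1` — OR a non-trivial vanishing ROW combination — then the row recurrence
(`propagate_of_rec`, `rotSys_all`, `rotSys_invariant`) makes `Z = {y : ∀ s, ∀ t < T, ℓ_s(rot^t y) = b_s}` rotation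
invariant, of degree `≤ 2·S·T ≤ L^{c+3}` (`prod_one_sub_sq`) and of size `≤ #E ≤ η_I·2ⁿ`, and `φ := 1 − 1_Z` leaves
`Bad = ∅`.  What remains undecided of the workshop hinge: non-linear polylog-degree body events and window-reading
tests.  No `def … : Prop`, no `instance`, no `notation`.
-/

set_option linter.style.longLine false
set_option linter.dupNamespace false

namespace Summit.QuantumAdvantage.QuantumAdvantage.Theorems.SteerDial

open Finset
open Literature.Computability.QuantumComplexity Literature.Computability.MetaComplexity
open Literature.Computability.QuantumComplexity.RingHLF
open Summit.QuantumAdvantage.AdviceFreeQNC0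
open Summit.QuantumAdvantage.QuantumAdvantage.Theses

section Counting

variable {N : ℕ}

/-- Half of the cube has `x i₀ = b`. -/
theorem aff_two_mul_card_apply_eq (i₀ : Fin N) (b : Bool) :
    2 * (univ.filter fun x : Fin N → Bool => x i₀ = b).card = 2 ^ N := by
  classical
  have hflip : (univ.filter fun x : Fin N → Bool => x i₀ = b).card =
      (univ.filter fun x : Fin N → Bool => ¬ x i₀ = b).card := by
    refine Finset.card_nbij' (fun x => Function.update x i₀ (!b)) (fun x => Function.update x i₀ b) ?_ ?_ ?_ ?_
    · intro x _
      simp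
    · intro x _
      simp
    · intro x hx
      simp only [mem_coe, mem_filter, mem_univ, true_and] at hx
      funext i
      by_cases h : i = i₀
      · subst h; simp [hx]
      · simp [Function.update, h]
    · intro x hx
      simp only [mem_coe, mem_filter, mem_univ, true_and] at hx
      funext i
      by_cases h : i = i₀
      · subst h; cases hb : x i <;> cases b <;> simp_all
      · simp [Function.update, h]
  have hsum := Finset.card_filter_add_card_filter_not (s := (univ : Finset (Fin N → Bool))) (fun x => x i₀ = b)
  rw [Finset.card_univ, Fintype.card_fun, Fintype.card_bool, Fintype.card_fin] at hsum
  omega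


/-- **Independence of junta events on disjoint supports, with bounds**: if every `C t` is a `U t`-junta event with
`2^N ≤ Llo·#C t` and `Lhi·#C t ≤ 2^N`, and the supports are pairwise disjoint, then
`2^N ≤ Llo^T·#{∀ t, y ∈ C t}` and `Lhi^T·#{∀ t, y ∈ C t} ≤ 2^N`. -/
theorem aff_junta_forall_bounds {T : ℕ} (C : Fin T → Finset (Fin N → Bool)) (U : Fin T → Finset (Fin N)) (Llo Lhi : ℕ)
    (hC : ∀ t, ∀ y y' : Fin N → Bool, (∀ i ∈ U t, y i = y' i) → (y ∈ C t ↔ y' ∈ C t))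
    (hlo : ∀ t, 2 ^ N ≤ Llo * (C t).card) (hhi : ∀ t, Lhi * (C t).card ≤ 2 ^ N)
    (hU : ∀ s t : Fin T, s ≠ t → Disjoint (U s) (U t)) :
    2 ^ N ≤ Llo ^ T * (univ.filter fun y : Fin N → Bool => ∀ t : Fin T, y ∈ C t).card ∧
      Lhi ^ T * (univ.filter fun y : Fin N → Bool => ∀ t : Fin T, y ∈ C t).card ≤ 2 ^ N := by
  classical
  set P : ℕ → Finset (Fin N → Bool) := fun j => univ.filter fun y => ∀ t : Fin T, t.val < j → y ∈ C t with hP_def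
  set V : ℕ → Finset (Fin N) := fun j => univ.filter fun i => ∃ t : Fin T, t.val < j ∧ i ∈ U t with hV_def
  have hPdep : ∀ j, ∀ y y' : Fin N → Bool, (∀ i ∈ V j, y i = y' i) → (y ∈ P j ↔ y' ∈ P j) := by
    intro j y y' hy
    simp only [hP_def, mem_filter, mem_univ, true_and]
    refine forall_congr' fun t => imp_congr_right fun ht => hC t y y' fun i hi => hy i ?_
    simp only [hV_def, mem_filter, mem_univ, true_and]
    exact ⟨t, ht, hi⟩
  have hstep : ∀ j (hj : j < T), (P (j + 1)).card * 2 ^ N = (P j).card * (C ⟨j, hj⟩).card := by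
    intro j hj
    set t₀ : Fin T := ⟨j, hj⟩
    have hPsucc : P (j + 1) = P j ∩ C t₀ := by
      ext y
      simp only [hP_def, mem_filter, mem_univ, true_and, mem_inter]
      constructor
      · intro h
        exact ⟨fun t ht => h t (by omega), h t₀ (by simp [t₀])⟩
      · rintro ⟨h, h0⟩ t ht
        rcases Nat.lt_succ_iff_lt_or_eq.1 ht with ht' | ht'
        · exact h t ht'
        · have : t = t₀ := Fin.ext (by simp [t₀, ht'])
          rw [this]; exact h0
    have hdisj : Disjoint (V j) (U t₀) := by
      rw [Finset.disjoint_left]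
      intro i hi hi0
      simp only [hV_def, mem_filter, mem_univ, true_and] at hi
      obtain ⟨t, ht, hit⟩ := hi
      have hne : t ≠ t₀ := by intro h; rw [h] at ht; simp [t₀] at ht
      exact disjoint_left.1 (hU t t₀ hne) hit hi0
    rw [hPsucc, card_inter_mul_of_depOn (hPdep j) (hC t₀) hdisj]
  have hpos : 0 < 2 ^ N := Nat.two_pow_pos N
  have hind : ∀ j, j ≤ T → 2 ^ N ≤ Llo ^ j * (P j).card ∧ Lhi ^ j * (P j).card ≤ 2 ^ N := by
    intro j
    induction j with
    | zero =>
      intro _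
      have : P 0 = univ := by ext y; simp [hP_def]
      rw [this]; simp
    | succ j ih =>
      intro hj
      have h1 := hstep j (by omega)
      obtain ⟨h2, h3⟩ := ih (by omega)
      have h4 := hlo ⟨j, by omega⟩
      have h5 := hhi ⟨j, by omega⟩
      constructor
      · -- 2^N * 2^N ≤ (Llo^j * #P j) * (Llo * #C) = Llo^(j+1) * (#P(j+1) * 2^N)
        have : 2 ^ N * 2 ^ N ≤ Llo ^ (j + 1) * (P (j + 1)).card * 2 ^ N := by
          calc 2 ^ N * 2 ^ N ≤ (Llo ^ j * (P j).card) * (Llo * (C ⟨j, by omega⟩).card) := Nat.mul_le_mul h2 h4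
            _ = Llo ^ (j + 1) * ((P j).card * (C ⟨j, by omega⟩).card) := by ring
            _ = Llo ^ (j + 1) * ((P (j + 1)).card * 2 ^ N) := by rw [h1]
            _ = Llo ^ (j + 1) * (P (j + 1)).card * 2 ^ N := by ring
        exact Nat.le_of_mul_le_mul_right this hpos
      · have : Lhi ^ (j + 1) * (P (j + 1)).card * 2 ^ N ≤ 2 ^ N * 2 ^ N := by
          calc Lhi ^ (j + 1) * (P (j + 1)).card * 2 ^ N = Lhi ^ (j + 1) * ((P (j + 1)).card * 2 ^ N) := by ring
            _ = Lhi ^ (j + 1) * ((P j).card * (C ⟨j, by omega⟩).card) := by rw [h1]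
            _ = (Lhi ^ j * (P j).card) * (Lhi * (C ⟨j, by omega⟩).card) := by ring
            _ ≤ 2 ^ N * 2 ^ N := Nat.mul_le_mul h3 h5
        exact Nat.le_of_mul_le_mul_right this hpos
  have hPT : P T = univ.filter fun y : Fin N → Bool => ∀ t : Fin T, y ∈ C t := by
    ext y; simp only [hP_def, mem_filter, mem_univ, true_and]
    exact ⟨fun h t => h t t.isLt, fun h t _ => h t⟩
  rw [← hPT]; exact hind T le_rfl

/-- Degree of a product of low-degree functions. -/
theorem aff_prod_mem_lowDeg {ι : Type*} (s : Finset ι) {D : ℕ} (f : ι → Smolensky.CubeFn (ZMod 3) N)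
    (h : ∀ i ∈ s, f i ∈ Smolensky.lowDeg (ZMod 3) N D) : (∏ i ∈ s, f i) ∈ Smolensky.lowDeg (ZMod 3) N (s.card * D) := by
  classical
  induction s using Finset.induction_on with
  | empty => simpa using Smolensky.one_mem_lowDeg (F := ZMod 3) (n := N) 0
  | insert a s ha ih =>
    rw [Finset.prod_insert ha, Finset.card_insert_of_notMem ha, show (s.card + 1) * D = D + s.card * D by ring]
    exact Smolensky.mul_mem_lowDeg_add (h a (Finset.mem_insert_self a s)) (ih fun i hi => h i (Finset.mem_insert_of_mem hi))


end Counting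


/-! ## LEMMA R and the column/recurrence dichotomy

`card_solSet_mul_le` is LEMMA R in coordinate form (if the columns of the system at `T` distinct coordinates are
linearly independent then every fibre of the affine system has `≤ 2^{n−T}` cube points — restriction off those
coordinates is injective on a fibre), `cols_dichotomy` is the rank-free dichotomy (either such coordinates exist, or a
non-trivial combination of the ROWS vanishes), and `rotSys_all_of_prefix` / `rotSys_invariant` are CASE B for rotated
copies of one affine form (a row recurrence propagates the first conditions to all rotations, so the solution set is
rotation-invariant).  (Workshop node «TagDial» rev 5 §10.) -/

section LinSys

variable {n T : ℕ}

/-- The cube points of the affine system `Σ_i M t i·[y_i] = β t` (`t < T`). -/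
def solSet (M : Fin T → Fin n → ZMod 3) (β : Fin T → ZMod 3) : Finset (Fin n → Bool) :=
  univ.filter fun y => ∀ t, ∑ i, M t i * (if y i then (1 : ZMod 3) else 0) = β t

/-- LEMMA R (PROVED): independent columns at `T` distinct coordinates ⇒ `#solSet · 2^T ≤ 2^n`. -/
theorem card_solSet_mul_le (M : Fin T → Fin n → ZMod 3) (β : Fin T → ZMod 3) (J : Fin T → Fin n)
    (hJ : Function.Injective J)
    (hli : LinearIndependent (ZMod 3) (fun t : Fin T => fun t' : Fin T => M t' (J t))) :
    (solSet M β).card * 2 ^ T ≤ 2 ^ n := by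
  classical
  set g : (Fin n → Bool) → (Fin n → Bool) := fun y i => if i ∈ Set.range J then false else y i with hg
  set Z : Finset (Fin n → Bool) := univ.filter fun z => ∀ t : Fin T, z (J t) = false with hZ
  have hmaps : ∀ y ∈ solSet M β, g y ∈ Z := by
    intro y _
    simp only [hZ, mem_filter, mem_univ, true_and, hg]
    intro t
    simp
  have hinj : Set.InjOn g (solSet M β : Set (Fin n → Bool)) := by
    intro y hy y' hy' hgg
    have hoff : ∀ i, i ∉ Set.range J → y i = y' i := by
      intro i hi
      have h := congr_fun hgg i
      simp only [hg] at h
      rwa [if_neg hi, if_neg hi] at h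
    simp only [solSet, coe_filter, Set.mem_setOf_eq, mem_univ, true_and] at hy hy'
    set δ : Fin T → ZMod 3 := fun t =>
      (if y (J t) then (1 : ZMod 3) else 0) - (if y' (J t) then 1 else 0) with hδ_def
    have hδ : ∑ t, δ t • (fun t' : Fin T => M t' (J t)) = 0 := by
      funext t'
      simp only [Finset.sum_apply, Pi.smul_apply, smul_eq_mul, Pi.zero_apply]
      have hsplit : ∑ i, M t' i * ((if y i then (1 : ZMod 3) else 0) - (if y' i then 1 else 0)) = 0 := by
        simp only [mul_sub, Finset.sum_sub_distrib, hy t', hy' t', sub_self]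
      have hvan : ∀ i ∈ (univ : Finset (Fin n)), i ∉ univ.image J →
          M t' i * ((if y i then (1 : ZMod 3) else 0) - (if y' i then 1 else 0)) = 0 := by
        intro i _ hi
        have hi' : i ∉ Set.range J := by
          intro h
          obtain ⟨t, rfl⟩ := h
          exact hi (mem_image_of_mem J (mem_univ t))
        rw [hoff i hi', sub_self, mul_zero]
      rw [← Finset.sum_subset (subset_univ (univ.image J)) hvan, Finset.sum_image (fun a _ b _ h => hJ h)]
        at hsplit
      rw [← hsplit]
      exact Finset.sum_congr rfl fun t _ => by rw [hδ_def, mul_comm]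
    have hδ0 : ∀ t, δ t = 0 := Fintype.linearIndependent_iff.mp hli δ hδ
    funext i
    by_cases hi : i ∈ Set.range J
    · obtain ⟨t, rfl⟩ := hi
      have h := hδ0 t
      simp only [hδ_def] at h
      cases h1 : y (J t) <;> cases h2 : y' (J t) <;> simp [h1, h2] at h ⊢
    · exact hoff i hi
  have hle : (solSet M β).card ≤ Z.card := Finset.card_le_card_of_injOn g hmaps hinj
  have hZb := (aff_junta_forall_bounds (N := n) (fun t => univ.filter fun z : Fin n → Bool => z (J t) = false)
    (fun t => {J t}) 2 2
    (by
      intro t y y' hyy'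
      simp only [mem_filter, mem_univ, true_and]
      rw [hyy' (J t) (mem_singleton_self _)])
    (fun t => by rw [aff_two_mul_card_apply_eq]) (fun t => by rw [aff_two_mul_card_apply_eq])
    (by
      intro s t hst
      rw [disjoint_singleton]
      exact fun h => hst (hJ h))).2
  have hZ' : (univ.filter fun y : Fin n → Bool => ∀ t : Fin T,
      y ∈ (univ.filter fun z : Fin n → Bool => z (J t) = false)) = Z := by
    rw [hZ]
    congr 1
    ext y
    simp
  rw [hZ'] at hZb
  calc (solSet M β).card * 2 ^ T ≤ Z.card * 2 ^ T := Nat.mul_le_mul_right _ hle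
    _ = 2 ^ T * Z.card := by ring
    _ ≤ 2 ^ n := hZb

/-- The rank-free dichotomy (PROVED): either `T` distinct coordinates carry linearly independent columns, or a
non-trivial linear combination of the rows vanishes. -/
theorem cols_dichotomy (M : Fin T → Fin n → ZMod 3) :
    (∃ J : Fin T → Fin n, Function.Injective J ∧
        LinearIndependent (ZMod 3) (fun t : Fin T => fun t' : Fin T => M t' (J t))) ∨
      (∃ lam : Fin T → ZMod 3, lam ≠ 0 ∧ ∀ i, ∑ t, lam t * M t i = 0) := by
  classical
  let v : Fin n → (Fin T → ZMod 3) := fun i t' => M t' i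
  obtain ⟨κ, a, ha, hspan, hli⟩ := exists_linearIndependent' (ZMod 3) v
  haveI : Fintype κ := Fintype.ofInjective a ha
  by_cases hT : T ≤ Fintype.card κ
  · left
    have hle : Fintype.card κ ≤ T := by
      have h := hli.fintype_card_le_finrank
      simpa [Module.finrank_fintype_fun_eq_card] using h
    have hcard : Fintype.card κ = T := le_antisymm hle hT
    let e : κ ≃ Fin T := Fintype.equivFinOfCardEq hcard
    refine ⟨a ∘ e.symm, ha.comp e.symm.injective, ?_⟩
    have : (fun t : Fin T => fun t' : Fin T => M t' ((a ∘ e.symm) t)) = (v ∘ a) ∘ e.symm := rfl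
    rw [this]
    exact hli.comp _ e.symm.injective
  · right
    rw [not_le] at hT
    have hlt : Submodule.span (ZMod 3) (Set.range v) < ⊤ := by
      rw [← hspan, lt_top_iff_ne_top]
      intro htop
      have h1 : Module.finrank (ZMod 3) (Submodule.span (ZMod 3) (Set.range (v ∘ a))) = Fintype.card κ :=
        finrank_span_eq_card hli
      rw [htop, finrank_top, Module.finrank_fintype_fun_eq_card, Fintype.card_fin] at h1
      omega
    obtain ⟨f, hf0, hker⟩ := Submodule.exists_le_ker_of_lt_top _ hlt
    refine ⟨fun t => f (fun j => if t = j then 1 else 0), ?_, ?_⟩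
    · intro hzero
      apply hf0
      apply LinearMap.ext
      intro x
      rw [LinearMap.pi_apply_eq_sum_univ f x, LinearMap.zero_apply]
      refine Finset.sum_eq_zero fun t _ => ?_
      have h := congr_fun hzero t
      simp only [Pi.zero_apply] at h
      rw [h, smul_zero]
    · intro i
      have hmem : v i ∈ Submodule.span (ZMod 3) (Set.range v) := Submodule.subset_span ⟨i, rfl⟩
      have h := hker hmem
      rw [LinearMap.mem_ker, LinearMap.pi_apply_eq_sum_univ f] at h
      simpa [v, smul_eq_mul, mul_comm] using h

end LinSys


end Summit.QuantumAdvantage.QuantumAdvantage.Theorems.SteerDial
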